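import Literature.Geometry.Symplectic.SteinBoundaryContact
import Literature.Topology.FourManifolds.Cobordism
import Mathlib.Geometry.Manifold.Diffeomorph

/-!
# Contactomorphisms between the boundaries of Stein domains (read on abstract boundary data)

For two compact Stein domains `(W₁, J₁)`, `(W₂, J₂)` (the tree's `SteinStructure`, real dimension `4`,
model `𝓡∂ 4`) with abstract boundary data `b₁ : BoundaryData (𝓡∂ 4) W₁ (𝓡 3)`,
`b₂ : BoundaryData (𝓡∂ 4) W₂ (𝓡 3)` (a boundaryless `3`-manifold `bᵢ.carrier` smoothly embedded onto `∂Wᵢ`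
by `bᵢ.incl`), a map `ψ : b₁.carrier → b₂.carrier` is a **contactomorphism** of the Stein-induced contact
structures `ξᵢ = T∂Wᵢ ∩ Jᵢ T∂Wᵢ` (`Literature.Geometry.Symplectic.contactPlane`) if its differential
carries the pulled-back plane field `d(incl₁)⁻¹ ξ₁` onto `d(incl₂)⁻¹ ξ₂`: for every tangent vector `v`
of the boundary manifold at `z`, `d(incl₂ ∘ ψ)_z v ∈ ξ₂` iff `d(incl₁)_z v ∈ ξ₁`
(Geiges, *An Introduction to Contact Topology* (2008), Def. 2.1.5: a contactomorphism is a
diffeomorphism `f` with `Tf(ξ₁) = ξ₂`; no coorientation is recorded).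

## Contents

* `IsContacto J₁ J₂ b₁ b₂ ψ` — the predicate;
* `IsContacto.refl`, `IsContacto.symm`, `IsContacto.trans` — contactomorphic diffeomorphisms form a
  groupoid (chain rule).

## Design choices

* Stated for a bare function `ψ` (the predicate only involves `mfderiv`); the groupoid lemmas are for
  Mathlib `Diffeomorph`s `b₁.carrier ≃ₘ⟮𝓡 3, 𝓡 3⟯ b₂.carrier`, as used by the cork vocabulary
  (`Literature.Topology.FourManifolds.ExtendsToDiffeomorph`, `Corks.lean`).
* Plane fields, not contact forms: `contactPlane J x` is a `Submodule ℝ (EuclideanSpace ℝ (Fin 4))` of the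
  model tangent space; this matches the contact-matching clause of the SPC4 route ConvexBisection
  (pushed-forward complex tangencies agree), from which `IsContacto` of the seam map is derived there.
* Deliberately NOT here: contact forms / coorientations, Gray stability, contact isotopy.
-/

noncomputable section

open scoped Manifold ContDiff Topology
open Set Function Literature.Topology.FourManifolds

namespace Literature.Geometry.Symplectic

variable {W₁ : Type*} [TopologicalSpace W₁] [ChartedSpace (EuclideanHalfSpace 4) W₁]
  [IsManifold (𝓡∂ 4) ∞ W₁] [CompactSpace W₁]
  {W₂ : Type*} [TopologicalSpace W₂] [ChartedSpace (EuclideanHalfSpace 4) W₂]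
  [IsManifold (𝓡∂ 4) ∞ W₂] [CompactSpace W₂]
  {W₃ : Type*} [TopologicalSpace W₃] [ChartedSpace (EuclideanHalfSpace 4) W₃]
  [IsManifold (𝓡∂ 4) ∞ W₃] [CompactSpace W₃]

/-- **`ψ : ∂W₁ → ∂W₂` is a contactomorphism `(∂W₁, ξ_{J₁}) → (∂W₂, ξ_{J₂})`** for the complex tangencies
of two Stein structures, read on abstract boundary data `b₁`, `b₂`: for every tangent vector `v` of the
boundary `3`-manifold at `z`, its image under `d(incl₂ ∘ ψ)_z` lies in the contact plane
`ξ_{J₂} = T∂W₂ ∩ J₂ T∂W₂` at `incl₂ (ψ z)` iff its image under `d(incl₁)_z` lies in `ξ_{J₁}` at `incl₁ z`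
(so `dψ` carries the pulled-back plane field `d(incl₁)⁻¹ ξ₁` onto `d(incl₂)⁻¹ ξ₂`; no coorientation is
recorded). Geiges, *An Introduction to Contact Topology* (2008), Def. 2.1.5.
[cite: Geiges2008, Def. 2.1.5] -/
def IsContacto (J₁ : SteinStructure W₁) (J₂ : SteinStructure W₂)
    (b₁ : BoundaryData (𝓡∂ 4) W₁ (𝓡 3)) (b₂ : BoundaryData (𝓡∂ 4) W₂ (𝓡 3))
    (ψ : b₁.carrier → b₂.carrier) : Prop :=
  ∀ (z : b₁.carrier) (v : EuclideanSpace ℝ (Fin 3)),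
    mfderiv (𝓡 3) (𝓡∂ 4) (b₂.incl ∘ ψ) z v ∈ contactPlane J₂.J (b₂.incl (ψ z)) ↔
      mfderiv (𝓡 3) (𝓡∂ 4) b₁.incl z v ∈ contactPlane J₁.J (b₁.incl z)

/-- The identity of `∂W` is a contactomorphism of `(∂W, ξ_J)`. Geiges (2008), §2.1. [folklore] -/
theorem IsContacto.refl (J : SteinStructure W₁) (b : BoundaryData (𝓡∂ 4) W₁ (𝓡 3)) :
    IsContacto J J b b (Diffeomorph.refl (𝓡 3) b.carrier ∞) := by
  intro z v
  rw [Diffeomorph.coe_refl, Function.comp_id]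
  rfl

/-- The inverse of a contactomorphic diffeomorphism is a contactomorphism (chain rule on
`ψ ∘ ψ⁻¹ = id`). Geiges (2008), §2.1. [folklore] -/
theorem IsContacto.symm {J₁ : SteinStructure W₁} {J₂ : SteinStructure W₂}
    {b₁ : BoundaryData (𝓡∂ 4) W₁ (𝓡 3)} {b₂ : BoundaryData (𝓡∂ 4) W₂ (𝓡 3)}
    {ψ : b₁.carrier ≃ₘ⟮𝓡 3, 𝓡 3⟯ b₂.carrier} (h : IsContacto J₁ J₂ b₁ b₂ ψ) :
    IsContacto J₂ J₁ b₂ b₁ ψ.symm := by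
  intro w u
  have hψ : MDifferentiableAt (𝓡 3) (𝓡 3) ψ (ψ.symm w) := ψ.mdifferentiable (by simp) _
  have hψs : MDifferentiableAt (𝓡 3) (𝓡 3) ψ.symm w := ψ.symm.mdifferentiable (by simp) _
  have hi₁ : MDifferentiableAt (𝓡 3) (𝓡∂ 4) b₁.incl (ψ.symm w) :=
    b₁.isSmoothEmbedding.contMDiff.mdifferentiableAt (by simp)
  have hi₂ : MDifferentiableAt (𝓡 3) (𝓡∂ 4) b₂.incl w :=
    b₂.isSmoothEmbedding.contMDiff.mdifferentiableAt (by simp)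
  -- `dψ (dψ⁻¹ u) = u`
  have key : mfderiv (𝓡 3) (𝓡 3) ψ (ψ.symm w) (mfderiv (𝓡 3) (𝓡 3) ψ.symm w u) = u := by
    rw [← mfderiv_comp_apply w hψ hψs u]
    have hid : ((ψ : b₁.carrier → b₂.carrier) ∘ (ψ.symm : b₂.carrier → b₁.carrier)) = id :=
      funext fun x => ψ.apply_symm_apply x
    rw [hid, mfderiv_id]
    rfl
  have e1 : mfderiv (𝓡 3) (𝓡∂ 4) (b₁.incl ∘ ⇑ψ.symm) w u =
      mfderiv (𝓡 3) (𝓡∂ 4) b₁.incl (ψ.symm w) (mfderiv (𝓡 3) (𝓡 3) ψ.symm w u) :=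
    mfderiv_comp_apply w hi₁ hψs u
  have e2 : mfderiv (𝓡 3) (𝓡∂ 4) (b₂.incl ∘ ⇑ψ) (ψ.symm w) (mfderiv (𝓡 3) (𝓡 3) ψ.symm w u) =
      mfderiv (𝓡 3) (𝓡∂ 4) b₂.incl w u := by
    rw [mfderiv_comp_apply_of_eq (ψ.symm w) hi₂ hψ (ψ.apply_symm_apply w), key]
  have h' := h (ψ.symm w) (mfderiv (𝓡 3) (𝓡 3) ψ.symm w u)
  rw [e2, ψ.apply_symm_apply] at h'
  rw [e1]
  exact h'.symm

/-- The composite of contactomorphic diffeomorphisms is a contactomorphism (chain rule).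
Geiges (2008), §2.1. [folklore] -/
theorem IsContacto.trans {J₁ : SteinStructure W₁} {J₂ : SteinStructure W₂} {J₃ : SteinStructure W₃}
    {b₁ : BoundaryData (𝓡∂ 4) W₁ (𝓡 3)} {b₂ : BoundaryData (𝓡∂ 4) W₂ (𝓡 3)}
    {b₃ : BoundaryData (𝓡∂ 4) W₃ (𝓡 3)}
    {ψ : b₁.carrier ≃ₘ⟮𝓡 3, 𝓡 3⟯ b₂.carrier} {ψ' : b₂.carrier ≃ₘ⟮𝓡 3, 𝓡 3⟯ b₃.carrier}
    (h : IsContacto J₁ J₂ b₁ b₂ ψ) (h' : IsContacto J₂ J₃ b₂ b₃ ψ') :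
    IsContacto J₁ J₃ b₁ b₃ (ψ.trans ψ') := by
  intro z v
  have hψ : MDifferentiableAt (𝓡 3) (𝓡 3) ψ z := ψ.mdifferentiable (by simp) _
  have hi₂ : MDifferentiableAt (𝓡 3) (𝓡∂ 4) b₂.incl (ψ z) :=
    b₂.isSmoothEmbedding.contMDiff.mdifferentiableAt (by simp)
  have hi₃ : MDifferentiableAt (𝓡 3) (𝓡∂ 4) (b₃.incl ∘ ⇑ψ') (ψ z) :=
    (b₃.isSmoothEmbedding.contMDiff.comp ψ'.contMDiff).mdifferentiableAt (by simp)
  have e0 : (b₃.incl ∘ ⇑(ψ.trans ψ')) = (b₃.incl ∘ ⇑ψ') ∘ ⇑ψ := rfl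
  have e1 : mfderiv (𝓡 3) (𝓡∂ 4) (b₃.incl ∘ ⇑(ψ.trans ψ')) z v =
      mfderiv (𝓡 3) (𝓡∂ 4) (b₃.incl ∘ ⇑ψ') (ψ z) (mfderiv (𝓡 3) (𝓡 3) ψ z v) := by
    rw [e0]
    exact mfderiv_comp_apply z hi₃ hψ v
  have e2 : mfderiv (𝓡 3) (𝓡∂ 4) (b₂.incl ∘ ⇑ψ) z v =
      mfderiv (𝓡 3) (𝓡∂ 4) b₂.incl (ψ z) (mfderiv (𝓡 3) (𝓡 3) ψ z v) :=
    mfderiv_comp_apply z hi₂ hψ v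
  have key := h' (ψ z) (mfderiv (𝓡 3) (𝓡 3) ψ z v)
  rw [← e2] at key
  rw [e1]
  exact key.trans (h z v)

end Literature.Geometry.Symplectic

end
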